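import Literature.Topology.FourManifolds.TrisectionFunctorGKInputs
import HarnessLib

/-!
# (T4) and fact (a′): van Kampen for the three sectors; `𝒢` lands in group trisections

Topic `Literature/Topology/FourManifolds` (fact seat
`provefact-Literature.Topology.FourManifolds.isGroupTrisection_groupGKTrisectionOf`).  This file
**discharges the named fact (a′) `isGroupTrisection_groupGKTrisectionOf`** of
`TrisectionFunctorGK.lean` — Abrams–Gay–Kirby, *Group trisections and smooth 4-manifolds*,
Geom. Topol. 22 (2018), p. 1540: *"There is an obvious map from the set of parametrized based
trisected 4-manifolds to the set of trisected groups, which we will call `𝒢`; the groups are the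
fundamental groups of the `Xᵢ`'s and their intersections, after identification with standard
models via the parametrizations, and the maps are those induced by inclusions composed with
parametrizations"* — by proving the last topological input (T4) of the reduction
`isGroupTrisection_groupGKTrisectionOf_of_fundamentalGroup` (`TrisectionFunctorGKProofs.lean`) and
assembling it with (T1)–(T3) (`TrisectionFunctorGKInputs.lean`):

* §1–§2: pulling normal closures back along surjections; factoring inclusion-induced maps;
* §3: `π₁(F) → π₁(X_l)` is onto with kernel `⟪K_{l+1} ∪ K_{l+2}⟫` ((T2) for
  `∂X_l = H_{l+1} ∪_F H_{l+2}` and (T3) `π₁(∂X_l) ≅ π₁(X_l)`);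
* §4 inner step (`IsGKTrisection.surjective_and_ker_eq_two_sectors`): van Kampen for
  `Xᵢ ∪ Xᵢ₊₁` glued along the handlebody `H_{i+2} = Xᵢ ∩ Xᵢ₊₁` — the collar of `H_{i+2}` inside a
  sector is the collar of the sector over the open neighbourhood `H_{i+2} ∪ K` of `H_{i+2}` in its
  boundary, `K` a collar of the central surface in the neighbouring handlebody (this handles the
  corner of the sectors along `F`);
* §5 outer step (`IsGKTrisection.surjective_and_ker_eq_sector_union`): van Kampen for
  `X_{i+2} ∪ (Xᵢ ∪ Xᵢ₊₁)` along `∂X_{i+2} = Hᵢ ∪ Hᵢ₊₁`, the collar on the side of `Xᵢ ∪ Xᵢ₊₁`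
  being pasted from the collars of the two sectors over `Hᵢ₊₁ ∪ K`, `Hᵢ ∪ K` (they fix their
  common points) and `K` absorbed at the end;
* §6 (T4) `IsGKTrisection.surjective_inclHom_iInter_and_ker_eq`: `π₁(F, x₀) → π₁(X, x₀)` is onto
  with kernel `⟪K₀ ∪ K₁ ∪ K₂⟫`;
* §7 `isGroupTrisection_groupGKTrisectionOf_holds`.

All van Kampen steps are instances of `VanKampen.surjective_and_ker_eq_of_closed_cover_collars`
(`VanKampenClosedCover.lean`, Hatcher's Thm. 1.20 for closed pieces with collars); the geometry
(collars, `∂X_l = S l ∩ (S (l+1) ∪ S (l+2))` by invariance of the boundary, connectivity) is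
`TrisectionSectorCollars.lean`.  Everything is proved; no definitions, no named facts.

## References

* A. Abrams, D. Gay, R. Kirby, *Group trisections and smooth 4-manifolds*, Geom. Topol. 22
  (2018) 1537–1545 (arXiv:1605.06731): the map `𝒢`, p. 1540; Def. 1, p. 1538; Thm. 5, p. 1541.
  [AbramsGayKirby2018]
* D. Gay, R. Kirby, *Trisecting 4-manifolds*, Geom. Topol. 20 (2016), Def. 1. [GayKirby2016]
* A. Hatcher, *Algebraic Topology* (2002), §1.2, Thm. 1.20 (van Kampen), Prop. 1.26.
  [HatcherAT2002]
-/

noncomputable section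

open Set Function Filter Topology
open scoped Manifold ContDiff

namespace Literature.Topology.FourManifolds

open Literature.AlgebraicTopology Literature.AlgebraicTopology.FundamentalGroup
  Literature.AlgebraicTopology.FundamentalGroup.VanKampen

universe u

/-! ### §1 Algebra: kernels, normal closures, surjections -/

section Algebra

variable {G N P : Type*} [Group G] [Group N] [Group P]

/-- **Pulling back a normal closure along a surjection.**  If `ψ : G → N` is surjective and
`ker ψ ≤ ⟪ψ⁻¹ s⟫` (e.g. `1 ∈ s`), then `ψ⁻¹ ⟪s⟫ = ⟪ψ⁻¹ s⟫`. [folklore] -/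
theorem comap_normalClosure_of_surjective (ψ : G →* N) (hψ : Function.Surjective ψ) (s : Set N)
    (hker : ψ.ker ≤ Subgroup.normalClosure (ψ ⁻¹' s)) :
    (Subgroup.normalClosure s).comap ψ = Subgroup.normalClosure (ψ ⁻¹' s) := by
  apply le_antisymm
  · -- `ψ⁻¹ ⟪s⟫ = ψ⁻¹ (ψ ⟪ψ⁻¹ s⟫) = ⟪ψ⁻¹ s⟫ ⊔ ker ψ = ⟪ψ⁻¹ s⟫`
    have hmap : (Subgroup.normalClosure (ψ ⁻¹' s)).map ψ = Subgroup.normalClosure s := by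
      rw [Subgroup.map_normalClosure _ _ hψ, image_preimage_eq s hψ]
    rw [← hmap, Subgroup.comap_map_eq, sup_eq_left.2 hker]
  · exact Subgroup.normalClosure_le_normal (fun x hx => Subgroup.subset_normalClosure hx)

/-- The kernel of `g ∘ f` is the preimage of the kernel of `g` (as sets). [folklore] -/
theorem preimage_ker_eq_ker_comp (f : G →* N) (g : N →* P) :
    (f ⁻¹' (g.ker : Set N)) = ((g.comp f).ker : Set G) := by
  ext x
  simp only [mem_preimage, SetLike.mem_coe, MonoidHom.mem_ker, MonoidHom.coe_comp, comp_apply]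

end Algebra

/-! ### §2 Factoring through intermediate subspaces -/

section Factor

variable {Y : Type*} [TopologicalSpace Y]

/-- If `π₁(A) → π₁(C)` is onto then so is `π₁(B) → π₁(C)` for `A ⊆ B ⊆ C`. [folklore] -/
theorem surjective_inclHomOfSubset_of_subset {A B C : Set Y} (hAB : A ⊆ B) (hBC : B ⊆ C) {x : Y}
    (hx : x ∈ A) (hs : Function.Surjective (inclHomOfSubset (hAB.trans hBC) x hx (hBC (hAB hx)))) :
    Function.Surjective (inclHomOfSubset hBC x (hAB hx) (hBC (hAB hx))) := by
  rw [← inclHomOfSubset_comp hAB hBC hx (hAB hx) (hBC (hAB hx)), MonoidHom.coe_comp] at hs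
  exact hs.of_comp

/-- The kernel of `π₁(A) → π₁(C)` is that of `π₁(A) → π₁(B)` when `π₁(B) → π₁(C)` is one-to-one,
`A ⊆ B ⊆ C`. [folklore] -/
theorem ker_inclHomOfSubset_eq_of_injective {A B C : Set Y} (hAB : A ⊆ B) (hBC : B ⊆ C) {x : Y}
    (hx : x ∈ A) (hi : Function.Injective (inclHomOfSubset hBC x (hAB hx) (hBC (hAB hx)))) :
    (inclHomOfSubset (hAB.trans hBC) x hx (hBC (hAB hx))).ker =
      (inclHomOfSubset hAB x hx (hAB hx)).ker := by
  rw [← inclHomOfSubset_comp hAB hBC hx (hAB hx) (hBC (hAB hx))]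
  exact MonoidHom.ker_comp_of_injective _ _ hi

end Factor

/-! ### §3 `π₁(F) → π₁(X_l)` is onto, with kernel `⟪K_{l+1} ∪ K_{l+2}⟫` -/

section Sector

variable {X : Type u} [TopologicalSpace X] [T2Space X] [SecondCountableTopology X]
  [ChartedSpace (EuclideanSpace ℝ (Fin 4)) X] {g : ℕ} {k : Fin 3 → ℕ} {S : Fin 3 → Set X}

omit [TopologicalSpace X] [T2Space X] [SecondCountableTopology X]
  [ChartedSpace (EuclideanSpace ℝ (Fin 4)) X] in
/-- The central surface lies in the boundary `∂X_l = S l ∩ (S (l+1) ∪ S (l+2))` of every sector.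
[cite: GayKirby2016, Def. 1] -/
theorem iInter_subset_sectorBoundary (S : Fin 3 → Set X) (l : Fin 3) :
    (⋂ m, S m) ⊆ S l ∩ (S (l + 1) ∪ S (l + 2)) := fun _ hx =>
  ⟨mem_iInter.1 hx l, Or.inl (mem_iInter.1 hx (l + 1))⟩

omit [T2Space X] [SecondCountableTopology X] [ChartedSpace (EuclideanSpace ℝ (Fin 4)) X] in
/-- Rewriting the target set does not change the kernel of `inclHomOfSubset`. [folklore] -/
theorem ker_inclHomOfSubset_congr {F T T' : Set X} (e : T = T') (hT : F ⊆ T) (hT' : F ⊆ T')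
    {x : X} (hx : x ∈ F) :
    (inclHomOfSubset hT x hx (hT hx)).ker = (inclHomOfSubset hT' x hx (hT' hx)).ker := by
  subst e
  rfl

/-- **`π₁(F) → π₁(∂X_l)` is onto with kernel `⟪K_{l+1} ∪ K_{l+2}⟫`** ((T2) for the splitting
`∂X_l = H_{l+1} ∪_F H_{l+2}`, re-indexed). [cite: AbramsGayKirby2018, p. 1540 (the map 𝒢)] -/
theorem IsGKTrisection.surjective_and_ker_eq_sectorBoundary (h : IsGKTrisection X g k S)
    (l : Fin 3) {x : X} (hx : x ∈ ⋂ m, S m) :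
    Function.Surjective (inclHomOfSubset (iInter_subset_sectorBoundary S l) x hx
        (iInter_subset_sectorBoundary S l hx)) ∧
      (inclHomOfSubset (iInter_subset_sectorBoundary S l) x hx
          (iInter_subset_sectorBoundary S l hx)).ker =
        Subgroup.normalClosure
          (((inclHomOfSubset (iInter_subset_inter S (l + 1)) x hx
              (iInter_subset_inter S (l + 1) hx)).ker : Set _) ∪
            (inclHomOfSubset (iInter_subset_inter S (l + 2)) x hx
              (iInter_subset_inter S (l + 2) hx)).ker) := by
  obtain ⟨hsurj, hker⟩ := h.surjective_and_ker_eq_handlebody_union (l + 1) hx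
  obtain ⟨e1, e2, e3, e4⟩ := fin3_add l
  -- the union of the two handlebodies is `∂X_l`
  have hU : (S (l + 1 + 1) ∩ S (l + 1 + 2)) ∪ (S (l + 1 + 1 + 1) ∩ S (l + 1 + 1 + 2)) =
      S l ∩ (S (l + 1) ∪ S (l + 2)) := by
    have h0 := union_handlebody_succ S (l + 1)
    have e5 : l + 1 + 1 + 1 = l := by rw [e1]; exact e3
    have e6 : l + 1 + 1 + 2 = l + 1 := by rw [e1]; exact e4
    rw [e5, e6, e1, e2] at h0
    rw [e5, e6, e1, e2]
    exact h0
  -- the second handlebody, re-indexed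
  have hH : S (l + 1 + 1 + 1) ∩ S (l + 1 + 1 + 2) = S (l + 2 + 1) ∩ S (l + 2 + 2) := by rw [e1]
  refine ⟨(surjective_inclHomOfSubset_congr' rfl hU
    ((iInter_subset_inter S (l + 1)).trans subset_union_left) (iInter_subset_sectorBoundary S l)
    hx hx).1 hsurj, ?_⟩
  rw [← ker_inclHomOfSubset_congr hU ((iInter_subset_inter S (l + 1)).trans subset_union_left)
    (iInter_subset_sectorBoundary S l) hx, hker,
    ker_inclHomOfSubset_congr hH (iInter_subset_inter S (l + 1 + 1)) (iInter_subset_inter S (l + 2)) hx]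

/-- **`π₁(F) → π₁(X_l)` is onto** for every sector of a Gay–Kirby trisection (composite of
`π₁(F) ↠ π₁(∂X_l)` and `π₁(∂X_l) ≅ π₁(X_l)`). [cite: AbramsGayKirby2018, p. 1540 (the map 𝒢)] -/
theorem IsGKTrisection.surjective_inclHomOfSubset_sector (h : IsGKTrisection X g k S) (l : Fin 3)
    {x : X} (hx : x ∈ ⋂ m, S m) :
    Function.Surjective (inclHomOfSubset (iInter_subset S l) x hx (iInter_subset S l hx)) := by
  have h1 := (h.surjective_and_ker_eq_sectorBoundary l hx).1
  have h2 := (h.bijective_inclHomOfSubset_sectorBoundary l (iInter_subset_sectorBoundary S l hx)).2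
  have hcomp := inclHomOfSubset_comp (iInter_subset_sectorBoundary S l)
    (inter_subset_left : S l ∩ (S (l + 1) ∪ S (l + 2)) ⊆ S l) hx
    (iInter_subset_sectorBoundary S l hx) (iInter_subset S l hx)
  have : Function.Surjective ((inclHomOfSubset (inter_subset_left : S l ∩ (S (l + 1) ∪ S (l + 2)) ⊆ S l)
      x (iInter_subset_sectorBoundary S l hx) (iInter_subset S l hx)).comp
      (inclHomOfSubset (iInter_subset_sectorBoundary S l) x hx (iInter_subset_sectorBoundary S l hx))) := by
    rw [MonoidHom.coe_comp]; exact h2.comp h1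
  rwa [hcomp] at this

/-- **The kernel of `π₁(F) → π₁(X_l)` is `⟪K_{l+1} ∪ K_{l+2}⟫`** (that of `π₁(F) → π₁(∂X_l)`,
since `π₁(∂X_l) ≅ π₁(X_l)`). [cite: AbramsGayKirby2018, p. 1540 (the map 𝒢)] -/
theorem IsGKTrisection.ker_inclHomOfSubset_sector (h : IsGKTrisection X g k S) (l : Fin 3)
    {x : X} (hx : x ∈ ⋂ m, S m) :
    (inclHomOfSubset (iInter_subset S l) x hx (iInter_subset S l hx)).ker =
      Subgroup.normalClosure
        (((inclHomOfSubset (iInter_subset_inter S (l + 1)) x hx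
            (iInter_subset_inter S (l + 1) hx)).ker : Set _) ∪
          (inclHomOfSubset (iInter_subset_inter S (l + 2)) x hx
            (iInter_subset_inter S (l + 2) hx)).ker) := by
  rw [← (h.surjective_and_ker_eq_sectorBoundary l hx).2]
  have hi := (h.bijective_inclHomOfSubset_sectorBoundary l (iInter_subset_sectorBoundary S l hx)).1
  exact ker_inclHomOfSubset_eq_of_injective (iInter_subset_sectorBoundary S l)
    (inter_subset_left : S l ∩ (S (l + 1) ∪ S (l + 2)) ⊆ S l) hx hi

end Sector

/-! ### §4 Inner step: two sectors along the handlebody between them -/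

section Inner

variable {X : Type u} [TopologicalSpace X] [T2Space X] [SecondCountableTopology X]
  [ChartedSpace (EuclideanSpace ℝ (Fin 4)) X] {g : ℕ} {k : Fin 3 → ℕ} {S : Fin 3 → Set X}

/-- **Van Kampen for two sectors `Xᵢ ∪ Xᵢ₊₁` glued along the handlebody `Xᵢ ∩ Xᵢ₊₁ = H_{i+2}`.**
For a Gay–Kirby trisection and a base point `x` of the central surface, the map
`π₁(Xᵢ ∩ Xᵢ₊₁, x) → π₁(Xᵢ ∪ Xᵢ₊₁, x)` is surjective with kernel
`⟪ker (→ π₁ Xᵢ) ∪ ker (→ π₁ Xᵢ₊₁)⟫`.  Seifert–van Kampen for the closed cover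
(`VanKampen.surjective_and_ker_eq_of_closed_cover_collars`); the collar of `H_{i+2}` inside
`Xᵢ` is the collar of the sector over the open neighbourhood `H_{i+2} ∪ K` of `H_{i+2}` in
`∂Xᵢ = H_{i+2} ∪ H_{i+1}`, `K` a collar of `F = ∂H_{i+1}` in `H_{i+1}` (this is how the corner of
the sectors along `F` is dealt with), and symmetrically inside `Xᵢ₊₁`.
[cite: AbramsGayKirby2018, p. 1540 (the map 𝒢)] [cite: HatcherAT2002, Thm. 1.20] -/
theorem IsGKTrisection.surjective_and_ker_eq_two_sectors (h : IsGKTrisection X g k S) (i : Fin 3)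
    {x : X} (hx : x ∈ ⋂ m, S m) :
    Function.Surjective (inclHomOfSubset
        (inter_subset_left.trans subset_union_left : S i ∩ S (i + 1) ⊆ S i ∪ S (i + 1)) x
        ⟨mem_iInter.1 hx i, mem_iInter.1 hx (i + 1)⟩ (Or.inl (mem_iInter.1 hx i))) ∧
      (inclHomOfSubset
          (inter_subset_left.trans subset_union_left : S i ∩ S (i + 1) ⊆ S i ∪ S (i + 1)) x
          ⟨mem_iInter.1 hx i, mem_iInter.1 hx (i + 1)⟩ (Or.inl (mem_iInter.1 hx i))).ker =
        Subgroup.normalClosure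
          (((inclHomOfSubset (inter_subset_left : S i ∩ S (i + 1) ⊆ S i) x
              ⟨mem_iInter.1 hx i, mem_iInter.1 hx (i + 1)⟩ (mem_iInter.1 hx i)).ker : Set _) ∪
            (inclHomOfSubset (inter_subset_right : S i ∩ S (i + 1) ⊆ S (i + 1)) x
              ⟨mem_iInter.1 hx i, mem_iInter.1 hx (i + 1)⟩ (mem_iInter.1 hx (i + 1))).ker) := by
  obtain ⟨e1, e2, e3, e4⟩ := fin3_add i
  have hxm := mem_iInter.1 hx
  have hx₀ : x ∈ S i ∩ S (i + 1) := ⟨hxm i, hxm (i + 1)⟩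
  have hF₀ : (⋂ m, S m) ⊆ S i ∩ S (i + 1) := fun y hy => ⟨mem_iInter.1 hy i, mem_iInter.1 hy (i + 1)⟩
  have hFmem : ∀ {y}, y ∈ S i → y ∈ S (i + 1) → y ∈ S (i + 2) → y ∈ ⋂ m, S m := by
    intro y h0 h1 h2
    refine mem_iInter.2 fun m => ?_
    have hcases : ∀ i j : Fin 3, j = i ∨ j = i + 1 ∨ j = i + 2 := by decide
    rcases hcases i m with rfl | rfl | rfl
    exacts [h0, h1, h2]
  -- the collars of `F` in the neighbouring handlebodies `S i ∩ S (i+2)` and `S (i+1) ∩ S (i+2)`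
  obtain ⟨K₁, O₁, hO₁, hK₁, hFK₁, hsdrK₁⟩ := h.exists_collar_centralSurface (i + 1)
  rw [e1, e2] at hK₁
  obtain ⟨K₂, O₂, hO₂, hK₂, hFK₂, hsdrK₂⟩ := h.exists_collar_centralSurface i
  -- the open neighbourhoods `N₁ ⊆ ∂Xᵢ`, `N₂ ⊆ ∂Xᵢ₊₁` of `S i ∩ S (i+1)` and the collars over them
  have hN₁ : (S i ∩ S (i + 1)) ∪ K₁ =
      (S i ∩ (S (i + 1) ∪ S (i + 2))) ∩ (S (i + 2) ∩ S i ∩ O₁ᶜ)ᶜ := by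
    ext y
    rw [hK₁]
    constructor
    · rintro (⟨h0, h1⟩ | ⟨⟨h2, h0⟩, hO⟩)
      · refine ⟨⟨h0, Or.inl h1⟩, ?_⟩
        rintro ⟨⟨h2, -⟩, hO⟩
        have hyK := hFK₁ (hFmem h0 h1 h2)
        rw [hK₁] at hyK
        exact hO hyK.2
      · exact ⟨⟨h0, Or.inr h2⟩, fun hc => hc.2 hO⟩
    · rintro ⟨⟨h0, h1 | h2⟩, hc⟩
      · exact Or.inl ⟨h0, h1⟩
      · refine Or.inr ⟨⟨h2, h0⟩, ?_⟩
        by_contra hO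
        exact hc ⟨⟨h2, h0⟩, hO⟩
  obtain ⟨C₁, U₁, hU₁, hC₁, -, hN₁C₁, hsdrC₁⟩ := h.exists_collar_sector i
    (((h.isClosed (i + 2)).inter (h.isClosed i)).sdiff hO₁).isOpen_compl
    (N := (S i ∩ S (i + 1)) ∪ K₁) (by rw [hN₁]; rfl)
  have hN₂ : (S i ∩ S (i + 1)) ∪ K₂ =
      (S (i + 1) ∩ (S (i + 1 + 1) ∪ S (i + 1 + 2))) ∩ (S (i + 1) ∩ S (i + 2) ∩ O₂ᶜ)ᶜ := by
    rw [e1, e2]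
    ext y
    rw [hK₂]
    constructor
    · rintro (⟨h0, h1⟩ | ⟨⟨h1, h2⟩, hO⟩)
      · refine ⟨⟨h1, Or.inr h0⟩, ?_⟩
        rintro ⟨⟨-, h2⟩, hO⟩
        have hyK := hFK₂ (hFmem h0 h1 h2)
        rw [hK₂] at hyK
        exact hO hyK.2
      · exact ⟨⟨h1, Or.inl h2⟩, fun hc => hc.2 hO⟩
    · rintro ⟨⟨h1, h2 | h0⟩, hc⟩
      · refine Or.inr ⟨⟨h1, h2⟩, ?_⟩
        by_contra hO
        exact hc ⟨⟨h1, h2⟩, hO⟩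
      · exact Or.inl ⟨h0, h1⟩
  obtain ⟨C₂, U₂, hU₂, hC₂, -, hN₂C₂, hsdrC₂⟩ := h.exists_collar_sector (i + 1)
    (((h.isClosed (i + 1)).inter (h.isClosed (i + 2))).sdiff hO₂).isOpen_compl
    (N := (S i ∩ S (i + 1)) ∪ K₂) (by rw [hN₂]; rfl)
  -- the collars retract onto `S i ∩ S (i+1)` (absorb `K₁`, `K₂` first)
  have hcl : IsClosed (S i ∩ S (i + 1)) := (h.isClosed i).inter (h.isClosed (i + 1))
  have hsdrN₁ : Homotopy.IsStrongDeformationRetractOf (S i ∩ S (i + 1)) ((S i ∩ S (i + 1)) ∪ K₁) :=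
    hsdrK₁.union_of_isClosed hcl ((h.isClosed (i + 2)).inter (h.isClosed i))
      (fun y hy => hFmem hy.1.1 hy.1.2 hy.2.1) hF₀ hFK₁ (by rw [hK₁]; exact inter_subset_left)
  have hsdrN₂ : Homotopy.IsStrongDeformationRetractOf (S i ∩ S (i + 1)) ((S i ∩ S (i + 1)) ∪ K₂) :=
    hsdrK₂.union_of_isClosed hcl ((h.isClosed (i + 1)).inter (h.isClosed (i + 2)))
      (fun y hy => hFmem hy.1.1 hy.1.2 hy.2.2) hF₀ hFK₂ (by rw [hK₂]; exact inter_subset_left)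
  have hsdr₁ := hsdrC₁.trans hsdrN₁ hN₁C₁ subset_union_left
  have hsdr₂ := hsdrC₂.trans hsdrN₂ hN₂C₂ subset_union_left
  -- the edge maps are onto (because `π₁(F) → π₁(X_m)` is)
  have hs₁ : Function.Surjective (inclHomOfSubset (inter_subset_left : S i ∩ S (i + 1) ⊆ S i) x hx₀
      (hxm i)) :=
    surjective_inclHomOfSubset_of_subset hF₀ inter_subset_left hx
      (h.surjective_inclHomOfSubset_sector i hx)
  have hs₂ : Function.Surjective (inclHomOfSubset (inter_subset_right : S i ∩ S (i + 1) ⊆ S (i + 1))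
      x hx₀ (hxm (i + 1))) :=
    surjective_inclHomOfSubset_of_subset hF₀ inter_subset_right hx
      (h.surjective_inclHomOfSubset_sector (i + 1) hx)
  -- path connectivity of `S i ∩ S (i+1) = H_{i+2}`
  have hpc : IsPathConnected (S i ∩ S (i + 1)) := by
    have := h.isPathConnected_handlebody (i + 2)
    rwa [e3, e4] at this
  exact surjective_and_ker_eq_of_closed_cover_collars (h.isClosed i) (h.isClosed (i + 1))
    inter_subset_left inter_subset_right Subset.rfl hU₁ hC₁ (subset_union_left.trans hN₁C₁) hU₂
    hC₂ (subset_union_left.trans hN₂C₂) hsdr₁ hsdr₂ (h.isPathConnected_sector i)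
    (h.isPathConnected_sector (i + 1)) hpc hx₀ hs₁ hs₂

end Inner

/-! ### §5 Outer step: a sector against the union of the other two, along its boundary -/

section Outer

variable {X : Type u} [TopologicalSpace X] [T2Space X] [SecondCountableTopology X]
  [ChartedSpace (EuclideanSpace ℝ (Fin 4)) X] {g : ℕ} {k : Fin 3 → ℕ} {S : Fin 3 → Set X}

/-- **Van Kampen for `X = X_{i+2} ∪ (Xᵢ ∪ Xᵢ₊₁)` glued along `∂X_{i+2} = Hᵢ ∪ Hᵢ₊₁`.**  For a
Gay–Kirby trisection and a base point `x` of the central surface, the map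
`π₁(∂X_{i+2}, x) → π₁(X, x)` (into `π₁` of `X_{i+2} ∪ (Xᵢ ∪ Xᵢ₊₁) = X`) is surjective with kernel
`⟪ker (→ π₁ X_{i+2}) ∪ ker (→ π₁ (Xᵢ ∪ Xᵢ₊₁))⟫`.  Seifert–van Kampen for the closed cover
(`VanKampen.surjective_and_ker_eq_of_closed_cover_collars`): on the side of `X_{i+2}` the collar of
its whole boundary; on the other side the union of the collars of `Xᵢ`, `Xᵢ₊₁` over the open
neighbourhoods `(Xᵢ ∩ X_{i+2}) ∪ K`, `(Xᵢ₊₁ ∩ X_{i+2}) ∪ K` of the two halves of `∂X_{i+2}` in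
`∂Xᵢ`, `∂Xᵢ₊₁`, with `K` a collar of `F` in the handlebody `Xᵢ ∩ Xᵢ₊₁` — these two collars fix
their common points (boundary points of both sectors), so their retractions paste, and `K` is
absorbed at the end. [cite: AbramsGayKirby2018, p. 1540 (the map 𝒢)] [cite: HatcherAT2002, Thm. 1.20] -/
theorem IsGKTrisection.surjective_and_ker_eq_sector_union (h : IsGKTrisection X g k S) (i : Fin 3)
    {x : X} (hx : x ∈ ⋂ m, S m) :
    Function.Surjective (inclHomOfSubset
        (inter_subset_left.trans subset_union_left :
          S (i + 2) ∩ (S i ∪ S (i + 1)) ⊆ S (i + 2) ∪ (S i ∪ S (i + 1))) x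
        ⟨mem_iInter.1 hx (i + 2), Or.inl (mem_iInter.1 hx i)⟩ (Or.inl (mem_iInter.1 hx (i + 2)))) ∧
      (inclHomOfSubset
          (inter_subset_left.trans subset_union_left :
            S (i + 2) ∩ (S i ∪ S (i + 1)) ⊆ S (i + 2) ∪ (S i ∪ S (i + 1))) x
          ⟨mem_iInter.1 hx (i + 2), Or.inl (mem_iInter.1 hx i)⟩ (Or.inl (mem_iInter.1 hx (i + 2)))).ker =
        Subgroup.normalClosure
          (((inclHomOfSubset (inter_subset_left : S (i + 2) ∩ (S i ∪ S (i + 1)) ⊆ S (i + 2)) x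
              ⟨mem_iInter.1 hx (i + 2), Or.inl (mem_iInter.1 hx i)⟩ (mem_iInter.1 hx (i + 2))).ker :
                Set _) ∪
            (inclHomOfSubset (inter_subset_right : S (i + 2) ∩ (S i ∪ S (i + 1)) ⊆ S i ∪ S (i + 1)) x
              ⟨mem_iInter.1 hx (i + 2), Or.inl (mem_iInter.1 hx i)⟩ (Or.inl (mem_iInter.1 hx i))).ker) := by
  obtain ⟨e1, e2, e3, e4⟩ := fin3_add i
  have hxm := mem_iInter.1 hx
  have hx₁ : x ∈ S (i + 2) ∩ (S i ∪ S (i + 1)) := ⟨hxm (i + 2), Or.inl (hxm i)⟩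
  have hFmem : ∀ {y}, y ∈ S i → y ∈ S (i + 1) → y ∈ S (i + 2) → y ∈ ⋂ m, S m := by
    intro y h0 h1 h2
    refine mem_iInter.2 fun m => ?_
    have hcases : ∀ i j : Fin 3, j = i ∨ j = i + 1 ∨ j = i + 2 := by decide
    rcases hcases i m with rfl | rfl | rfl
    exacts [h0, h1, h2]
  have hFF₁ : (⋂ m, S m) ⊆ S (i + 2) ∩ (S i ∪ S (i + 1)) := fun y hy =>
    ⟨mem_iInter.1 hy (i + 2), Or.inl (mem_iInter.1 hy i)⟩
  -- closed sets
  have hcl : ∀ m, IsClosed (S m) := h.isClosed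
  have hbd₀ : IsClosed (S i ∩ (S (i + 1) ∪ S (i + 2))) := (hcl i).inter ((hcl _).union (hcl _))
  have hbd₁ : IsClosed (S (i + 1) ∩ (S (i + 2) ∪ S i)) := (hcl _).inter ((hcl _).union (hcl _))
  have hF₁cl : IsClosed (S (i + 2) ∩ (S i ∪ S (i + 1))) := (hcl _).inter ((hcl _).union (hcl _))
  -- (1) the collar of the whole boundary of `X_{i+2}`
  obtain ⟨Cl, Ul, hUl, hCl, -, hNCl, hsdrCl⟩ := h.exists_collar_sector (i + 2) isOpen_univ
    (N := S (i + 2) ∩ (S (i + 2 + 1) ∪ S (i + 2 + 2))) (by rw [inter_univ])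
  rw [e3, e4] at hNCl hsdrCl
  -- (2) the collar `K` of `F` in the handlebody `S i ∩ S (i+1)`
  obtain ⟨K, O, hO, hK, hFK, hsdrK⟩ := h.exists_collar_centralSurface (i + 2)
  rw [e3, e4] at hK
  have hKmem : ∀ {y}, y ∈ K ↔ y ∈ S i ∧ y ∈ S (i + 1) ∧ y ∈ O := fun {y} => by
    rw [hK]; simp only [mem_inter_iff, and_assoc]
  have hFO : ∀ {y}, y ∈ S i → y ∈ S (i + 1) → y ∈ S (i + 2) → y ∈ O := fun h0 h1 h2 =>
    (hKmem.1 (hFK (hFmem h0 h1 h2))).2.2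
  -- (3) the open neighbourhoods `Nⁱ ⊆ ∂Xᵢ`, `Nʲ ⊆ ∂Xᵢ₊₁` and the collars over them
  have hOc : IsOpen (S i ∩ S (i + 1) ∩ Oᶜ)ᶜ := (((hcl i).inter (hcl (i + 1))).sdiff hO).isOpen_compl
  have hNi : (S i ∩ S (i + 2)) ∪ K = (S i ∩ (S (i + 1) ∪ S (i + 2))) ∩ (S i ∩ S (i + 1) ∩ Oᶜ)ᶜ := by
    ext y
    constructor
    · rintro (⟨h0, h2⟩ | hyK)
      · refine ⟨⟨h0, Or.inr h2⟩, ?_⟩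
        rintro ⟨⟨-, h1⟩, hO⟩
        exact hO (hFO h0 h1 h2)
      · obtain ⟨h0, h1, hyO⟩ := hKmem.1 hyK
        exact ⟨⟨h0, Or.inl h1⟩, fun hc => hc.2 hyO⟩
    · rintro ⟨⟨h0, h1 | h2⟩, hc⟩
      · refine Or.inr (hKmem.2 ⟨h0, h1, ?_⟩)
        by_contra hO
        exact hc ⟨⟨h0, h1⟩, hO⟩
      · exact Or.inl ⟨h0, h2⟩
  obtain ⟨Ci, Ui, hUi, hCi, hCiN, hNCi, hsdrCi⟩ := h.exists_collar_sector i hOc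
    (N := (S i ∩ S (i + 2)) ∪ K) hNi
  have hNj : (S (i + 1) ∩ S (i + 2)) ∪ K =
      (S (i + 1) ∩ (S (i + 1 + 1) ∪ S (i + 1 + 2))) ∩ (S i ∩ S (i + 1) ∩ Oᶜ)ᶜ := by
    rw [e1, e2]
    ext y
    constructor
    · rintro (⟨h1, h2⟩ | hyK)
      · refine ⟨⟨h1, Or.inl h2⟩, ?_⟩
        rintro ⟨⟨h0, -⟩, hO⟩
        exact hO (hFO h0 h1 h2)
      · obtain ⟨h0, h1, hyO⟩ := hKmem.1 hyK
        exact ⟨⟨h1, Or.inr h0⟩, fun hc => hc.2 hyO⟩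
    · rintro ⟨⟨h1, h2 | h0⟩, hc⟩
      · exact Or.inl ⟨h1, h2⟩
      · refine Or.inr (hKmem.2 ⟨h0, h1, ?_⟩)
        by_contra hO
        exact hc ⟨⟨h0, h1⟩, hO⟩
  obtain ⟨Cj, Uj, hUj, hCj, hCjN, hNCj, hsdrCj⟩ := h.exists_collar_sector (i + 1) hOc
    (N := (S (i + 1) ∩ S (i + 2)) ∪ K) hNj
  rw [e1, e2] at hCjN
  -- elementary consequences
  have hCiS : Ci ⊆ S i := fun y hy => (hCi ▸ hy : y ∈ S i ∩ Ui).1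
  have hCjS : Cj ⊆ S (i + 1) := fun y hy => (hCj ▸ hy : y ∈ S (i + 1) ∩ Uj).1
  have hKNi : K ⊆ (S i ∩ S (i + 2)) ∪ K := subset_union_right
  have hKNj : K ⊆ (S (i + 1) ∩ S (i + 2)) ∪ K := subset_union_right
  -- a point of `Cⁱ` in `S (i+1)` lies in `K` (hence in `Cʲ`), and symmetrically
  have hCiK : ∀ {y}, y ∈ Ci → y ∈ S (i + 1) → y ∈ K := by
    intro y hyC h1
    have h0 : y ∈ S i := hCiS hyC
    have hyN : y ∈ (S i ∩ S (i + 2)) ∪ K := by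
      rw [← hCiN]; exact ⟨hyC, h0, Or.inl h1⟩
    rcases hyN with ⟨-, h2⟩ | hyK
    · exact hFK (hFmem h0 h1 h2)
    · exact hyK
  have hCjK : ∀ {y}, y ∈ Cj → y ∈ S i → y ∈ K := by
    intro y hyC h0
    have h1 : y ∈ S (i + 1) := hCjS hyC
    have hyN : y ∈ (S (i + 1) ∩ S (i + 2)) ∪ K := by
      rw [← hCjN]; exact ⟨hyC, h1, Or.inr h0⟩
    rcases hyN with ⟨-, h2⟩ | hyK
    · exact hFK (hFmem h0 h1 h2)
    · exact hyK
  -- (4) `C = Cⁱ ∪ Cʲ` is open in `S i ∪ S (i+1)`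
  have hCopen : Ci ∪ Cj = (S i ∪ S (i + 1)) ∩ ((Ui ∩ Uj) ∪ (Ui ∩ (S (i + 1))ᶜ) ∪ (Uj ∩ (S i)ᶜ)) := by
    apply Subset.antisymm
    · rintro y (hyC | hyC)
      · have hyU : y ∈ Ui := (hCi ▸ hyC : y ∈ S i ∩ Ui).2
        refine ⟨Or.inl (hCiS hyC), ?_⟩
        by_cases h1 : y ∈ S (i + 1)
        · have hyCj : y ∈ Cj := hNCj (hKNj (hCiK hyC h1))
          exact Or.inl (Or.inl ⟨hyU, (hCj ▸ hyCj : y ∈ S (i + 1) ∩ Uj).2⟩)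
        · exact Or.inl (Or.inr ⟨hyU, h1⟩)
      · have hyU : y ∈ Uj := (hCj ▸ hyC : y ∈ S (i + 1) ∩ Uj).2
        refine ⟨Or.inr (hCjS hyC), ?_⟩
        by_cases h0 : y ∈ S i
        · have hyCi : y ∈ Ci := hNCi (hKNi (hCjK hyC h0))
          exact Or.inl (Or.inl ⟨(hCi ▸ hyCi : y ∈ S i ∩ Ui).2, hyU⟩)
        · exact Or.inr ⟨hyU, h0⟩
    · rintro y ⟨hyS, ((⟨hyUi, hyUj⟩ | ⟨hyUi, hy1⟩) | ⟨hyUj, hy0⟩)⟩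
      · rcases hyS with h0 | h1
        · exact Or.inl (hCi ▸ ⟨h0, hyUi⟩)
        · exact Or.inr (hCj ▸ ⟨h1, hyUj⟩)
      · rcases hyS with h0 | h1
        · exact Or.inl (hCi ▸ ⟨h0, hyUi⟩)
        · exact absurd h1 hy1
      · rcases hyS with h0 | h1
        · exact absurd h0 hy0
        · exact Or.inr (hCj ▸ ⟨h1, hyUj⟩)
  have hOpen : IsOpen ((Ui ∩ Uj) ∪ (Ui ∩ (S (i + 1))ᶜ) ∪ (Uj ∩ (S i)ᶜ)) :=
    ((hUi.inter hUj).union (hUi.inter (hcl _).isOpen_compl)).union (hUj.inter (hcl _).isOpen_compl)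
  -- (5) `Cⁱ ∪ Cʲ` strong deformation retracts onto `∂X_{i+2}`
  --   (a) retract `Cⁱ` onto `Nⁱ`, keeping `Cʲ` fixed
  have hNiBd : (S i ∩ S (i + 2)) ∪ K ⊆ S i ∩ (S (i + 1) ∪ S (i + 2)) := by
    rw [hNi]; exact inter_subset_left
  have hNjBd : (S (i + 1) ∩ S (i + 2)) ∪ K ⊆ S (i + 1) ∩ (S (i + 2) ∪ S i) := by
    have := hNj; rw [e1, e2] at this; rw [this]; exact inter_subset_left
  have hCiBd : ∀ {y}, y ∈ Ci → y ∈ S i ∩ (S (i + 1) ∪ S (i + 2)) → y ∈ (S i ∩ S (i + 2)) ∪ K :=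
    fun hyC hyB => by rw [← hCiN]; exact ⟨hyC, hyB⟩
  have hCjBd : ∀ {y}, y ∈ Cj → y ∈ S (i + 1) ∩ (S (i + 2) ∪ S i) → y ∈ (S (i + 1) ∩ S (i + 2)) ∪ K :=
    fun hyC hyB => by rw [← hCjN]; exact ⟨hyC, hyB⟩
  have stepA : Homotopy.IsStrongDeformationRetractOf (Cj ∪ ((S i ∩ S (i + 2)) ∪ K)) (Ci ∪ Cj) := by
    have h1 := hsdrCi.union_of_inter_subset (P := Cj ∪ ((S i ∩ S (i + 2)) ∪ K)) ?_ ?_ ?_ ?_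
    · have hset : (Cj ∪ ((S i ∩ S (i + 2)) ∪ K)) ∪ Ci = Ci ∪ Cj := by
        apply Subset.antisymm
        · rintro y ((hy | hy) | hy)
          exacts [Or.inr hy, Or.inl (hNCi hy), Or.inl hy]
        · rintro y (hy | hy)
          exacts [Or.inr hy, Or.inl (Or.inl hy)]
      rw [hset] at h1
      exact h1
    · rintro y ⟨hyC | hyN, hyCi⟩
      · exact hCiBd hyCi ⟨hCiS hyCi, Or.inl (hCjS hyC)⟩
      · exact hyN
    · exact fun y hy => Or.inr hy.1
    · rintro y ⟨hycl, hyCi⟩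
      have hsub : closure (Cj ∪ ((S i ∩ S (i + 2)) ∪ K)) ⊆ S (i + 1) ∪ S i ∩ (S (i + 1) ∪ S (i + 2)) :=
        closure_minimal (union_subset_union hCjS hNiBd) ((hcl _).union hbd₀)
      rcases hsub hycl with h1 | hB
      · exact Or.inr (hCiBd hyCi ⟨hCiS hyCi, Or.inl h1⟩)
      · exact Or.inr (hCiBd hyCi hB)
    · rintro y ⟨hycl, hyP⟩
      have h0 : y ∈ S i := closure_minimal hCiS (hcl i) hycl
      rcases hyP with hyC | hyN
      · exact hNCi (hKNi (hCjK hyC h0))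
      · exact hNCi hyN
  --   (b) retract `Cʲ` onto `Nʲ`, keeping `Nⁱ` fixed
  have stepB : Homotopy.IsStrongDeformationRetractOf
      (((S i ∩ S (i + 2)) ∪ K) ∪ ((S (i + 1) ∩ S (i + 2)) ∪ K)) (Cj ∪ ((S i ∩ S (i + 2)) ∪ K)) := by
    have h1 := hsdrCj.union_of_inter_subset
      (P := ((S i ∩ S (i + 2)) ∪ K) ∪ ((S (i + 1) ∩ S (i + 2)) ∪ K)) ?_ ?_ ?_ ?_
    · have hset : (((S i ∩ S (i + 2)) ∪ K) ∪ ((S (i + 1) ∩ S (i + 2)) ∪ K)) ∪ Cj =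
          Cj ∪ ((S i ∩ S (i + 2)) ∪ K) := by
        apply Subset.antisymm
        · rintro y ((hy | hy) | hy)
          exacts [Or.inr hy, Or.inl (hNCj hy), Or.inl hy]
        · rintro y (hy | hy)
          exacts [Or.inr hy, Or.inl (Or.inl hy)]
      rw [hset] at h1
      exact h1
    · rintro y ⟨hyNi | hyNj, hyCj⟩
      · have h0 : y ∈ S i := (hNiBd hyNi).1
        exact hCjBd hyCj ⟨hCjS hyCj, Or.inr h0⟩
      · exact hyNj
    · exact fun y hy => Or.inr hy.1
    · rintro y ⟨hycl, hyCj⟩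
      have hsub : closure (((S i ∩ S (i + 2)) ∪ K) ∪ ((S (i + 1) ∩ S (i + 2)) ∪ K)) ⊆
          S i ∩ (S (i + 1) ∪ S (i + 2)) ∪ S (i + 1) ∩ (S (i + 2) ∪ S i) :=
        closure_minimal (union_subset_union hNiBd hNjBd) (hbd₀.union hbd₁)
      rcases hsub hycl with hB | hB
      · exact Or.inr (hCjBd hyCj ⟨hCjS hyCj, Or.inr hB.1⟩)
      · exact Or.inr (hCjBd hyCj hB)
    · rintro y ⟨hycl, hyP⟩
      have h1 : y ∈ S (i + 1) := closure_minimal hCjS (hcl _) hycl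
      rcases hyP with hyNi | hyNj
      · rcases hyNi with ⟨h0, h2⟩ | hyK
        · exact hNCj (hKNj (hFK (hFmem h0 h1 h2)))
        · exact hNCj (hKNj hyK)
      · exact hNCj hyNj
  --   (c) compose, (d) absorb `K` into `∂X_{i+2}`, (e) compose
  have stepC := stepA.trans stepB (union_subset subset_union_right (hNCi.trans subset_union_left))
    (union_subset subset_union_right (hNCj.trans subset_union_left))
  have hNN : ((S i ∩ S (i + 2)) ∪ K) ∪ ((S (i + 1) ∩ S (i + 2)) ∪ K) =
      (S (i + 2) ∩ (S i ∪ S (i + 1))) ∪ K := by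
    ext y; simp only [mem_union, mem_inter_iff]; tauto
  have stepD : Homotopy.IsStrongDeformationRetractOf (S (i + 2) ∩ (S i ∪ S (i + 1)))
      ((S (i + 2) ∩ (S i ∪ S (i + 1))) ∪ K) :=
    hsdrK.union_of_isClosed hF₁cl ((hcl i).inter (hcl (i + 1)))
      (fun y hy => hFmem hy.2.1 hy.2.2 hy.1.1) hFF₁ hFK (by rw [hK]; exact inter_subset_left)
  rw [← hNN] at stepD
  have stepE : Homotopy.IsStrongDeformationRetractOf (S (i + 2) ∩ (S i ∪ S (i + 1))) (Ci ∪ Cj) :=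
    stepC.trans stepD (union_subset (hNCi.trans subset_union_left) (hNCj.trans subset_union_right))
      (by rw [hNN]; exact subset_union_left)
  -- (6) the edge maps are onto
  have eB : S (i + 2) ∩ (S (i + 2 + 1) ∪ S (i + 2 + 2)) = S (i + 2) ∩ (S i ∪ S (i + 1)) := by
    rw [e3, e4]
  have hx₁' : x ∈ S (i + 2) ∩ (S (i + 2 + 1) ∪ S (i + 2 + 2)) := by rw [eB]; exact hx₁
  have hbij := h.bijective_inclHomOfSubset_sectorBoundary (i + 2) hx₁'
  have hs₁ : Function.Surjective (inclHomOfSubset (inter_subset_left : S (i + 2) ∩ (S i ∪ S (i + 1)) ⊆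
      S (i + 2)) x hx₁ (hxm (i + 2))) :=
    (surjective_inclHomOfSubset_congr' eB rfl inter_subset_left inter_subset_left hx₁' hx₁).1 hbij.2
  have eH : S (i + 2 + 1) ∩ S (i + 2 + 2) = S i ∩ S (i + 1) := by rw [e3, e4]
  have hT1 := (surjective_inclHomOfSubset_congr' rfl eH (iInter_subset_inter S (i + 2))
    (fun y hy => ⟨mem_iInter.1 hy i, mem_iInter.1 hy (i + 1)⟩) hx hx).1
    (h.surjective_inclHomOfSubset_handlebody (i + 2) hx)
  have hinner := (h.surjective_and_ker_eq_two_sectors i hx).1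
  have hFU : (⋂ m, S m) ⊆ S i ∩ S (i + 1) := fun y hy => ⟨mem_iInter.1 hy i, mem_iInter.1 hy (i + 1)⟩
  have hs₂' : Function.Surjective (inclHomOfSubset
      (hFU.trans (inter_subset_left.trans subset_union_left) : (⋂ m, S m) ⊆ S i ∪ S (i + 1)) x hx
      (Or.inl (hxm i))) := by
    rw [← inclHomOfSubset_comp hFU (inter_subset_left.trans subset_union_left :
      S i ∩ S (i + 1) ⊆ S i ∪ S (i + 1)) hx ⟨hxm i, hxm (i + 1)⟩ (Or.inl (hxm i)), MonoidHom.coe_comp]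
    exact hinner.comp hT1
  have hs₂ : Function.Surjective (inclHomOfSubset (inter_subset_right : S (i + 2) ∩ (S i ∪ S (i + 1)) ⊆
      S i ∪ S (i + 1)) x hx₁ (Or.inl (hxm i))) :=
    surjective_inclHomOfSubset_of_subset hFF₁ inter_subset_right hx hs₂'
  -- (7) path connectivity of `∂X_{i+2}`
  have hpc : IsPathConnected (S (i + 2) ∩ (S i ∪ S (i + 1))) := by
    have := h.isPathConnected_inter_union (i + 2)
    rwa [e3, e4] at this
  have hFC₂ : S (i + 2) ∩ (S i ∪ S (i + 1)) ⊆ Ci ∪ Cj := by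
    rintro y ⟨h2, h0 | h1⟩
    · exact Or.inl (hNCi (Or.inl ⟨h0, h2⟩))
    · exact Or.inr (hNCj (Or.inl ⟨h1, h2⟩))
  exact surjective_and_ker_eq_of_closed_cover_collars (hcl (i + 2)) ((hcl i).union (hcl (i + 1)))
    inter_subset_left inter_subset_right Subset.rfl hUl hCl hNCl hOpen hCopen hFC₂
    hsdrCl stepE (h.isPathConnected_sector (i + 2)) (h.isPathConnected_union i (i + 1)) hpc hx₁ hs₁ hs₂

end Outer

/-! ### §6 (T4): `π₁(F) → π₁(X)` is onto with kernel `⟪K₀ ∪ K₁ ∪ K₂⟫` -/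

section Whole

variable {X : Type u} [TopologicalSpace X] [T2Space X] [SecondCountableTopology X]
  [ChartedSpace (EuclideanSpace ℝ (Fin 4)) X] {g : ℕ} {k : Fin 3 → ℕ} {S : Fin 3 → Set X}

/-- **(T4): van Kampen for the three sectors.**  For a Gay–Kirby trisection of `X` and a base
point `x` of the central surface `F`, the map `π₁(F, x) → π₁(X, x)` induced by the inclusion is
surjective and its kernel is the normal closure of `Kᵢ ∪ Kᵢ₊₁ ∪ Kᵢ₊₂`,
`K_m = ker (π₁ F → π₁ H_m)`: combine the outer step for `X = X_{i+2} ∪ (Xᵢ ∪ Xᵢ₊₁)` along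
`∂X_{i+2}`, the inner step for `Xᵢ ∪ Xᵢ₊₁` along `H_{i+2}`, `π₁(F) ↠ π₁(∂X_l)` with kernel
`⟪K_{l+1} ∪ K_{l+2}⟫` and `π₁(∂X_l) ≅ π₁(X_l)` ((T2), (T3)), pulling normal closures back along
surjections. [cite: AbramsGayKirby2018, p. 1540 (the map 𝒢)] [cite: HatcherAT2002, Thm. 1.20] -/
theorem IsGKTrisection.surjective_inclHom_iInter_and_ker_eq (h : IsGKTrisection X g k S) (i : Fin 3)
    {x : X} (hx : x ∈ ⋂ m, S m) :
    Function.Surjective (inclHom (⋂ m, S m) x hx) ∧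
      (inclHom (⋂ m, S m) x hx).ker = Subgroup.normalClosure
        ((((inclHomOfSubset (iInter_subset_inter S i) x hx (iInter_subset_inter S i hx)).ker : Set _) ∪
          (inclHomOfSubset (iInter_subset_inter S (i + 1)) x hx (iInter_subset_inter S (i + 1) hx)).ker) ∪
          (inclHomOfSubset (iInter_subset_inter S (i + 2)) x hx (iInter_subset_inter S (i + 2) hx)).ker) := by
  obtain ⟨e1, e2, e3, e4⟩ := fin3_add i
  have hxm := mem_iInter.1 hx
  -- the cover `U = X_{i+2} ∪ (Xᵢ ∪ Xᵢ₊₁) = X`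
  have hU : S (i + 2) ∪ (S i ∪ S (i + 1)) = univ := by
    refine eq_univ_of_forall fun y => ?_
    obtain ⟨m, hm⟩ := h.exists_mem y
    have hcases : ∀ i j : Fin 3, j = i ∨ j = i + 1 ∨ j = i + 2 := by decide
    rcases hcases i m with rfl | rfl | rfl
    exacts [Or.inr (Or.inl hm), Or.inr (Or.inr hm), Or.inl hm]
  have hFF₁ : (⋂ m, S m) ⊆ S (i + 2) ∩ (S i ∪ S (i + 1)) := fun y hy =>
    ⟨mem_iInter.1 hy (i + 2), Or.inl (mem_iInter.1 hy i)⟩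
  have hF₁U : S (i + 2) ∩ (S i ∪ S (i + 1)) ⊆ S (i + 2) ∪ (S i ∪ S (i + 1)) :=
    inter_subset_left.trans subset_union_left
  have hFU : (⋂ m, S m) ⊆ S (i + 2) ∪ (S i ∪ S (i + 1)) := hFF₁.trans hF₁U
  have hx₁ : x ∈ S (i + 2) ∩ (S i ∪ S (i + 1)) := hFF₁ hx
  have hxU : x ∈ S (i + 2) ∪ (S i ∪ S (i + 1)) := hFU hx
  -- `ψ : π₁(F) ↠ π₁(∂X_{i+2})`, kernel `⟪Kᵢ ∪ Kᵢ₊₁⟫`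
  have eB : S (i + 2) ∩ (S (i + 2 + 1) ∪ S (i + 2 + 2)) = S (i + 2) ∩ (S i ∪ S (i + 1)) := by
    rw [e3, e4]
  obtain ⟨hψs', hψk'⟩ := h.surjective_and_ker_eq_sectorBoundary (i + 2) hx
  have hψs : Function.Surjective (inclHomOfSubset hFF₁ x hx hx₁) :=
    (surjective_inclHomOfSubset_congr' rfl eB (iInter_subset_sectorBoundary S (i + 2)) hFF₁ hx hx).1 hψs'
  -- the outer step
  obtain ⟨hos, hok⟩ := h.surjective_and_ker_eq_sector_union i hx
  -- `a : π₁(∂X_{i+2}) → π₁(X_{i+2})` is one-to-one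
  have hx₁' : x ∈ S (i + 2) ∩ (S (i + 2 + 1) ∪ S (i + 2 + 2)) := by rw [eB]; exact hx₁
  have hbij := h.bijective_inclHomOfSubset_sectorBoundary (i + 2) hx₁'
  have hai : Function.Injective (inclHomOfSubset (inter_subset_left : S (i + 2) ∩ (S i ∪ S (i + 1)) ⊆
      S (i + 2)) x hx₁ (hxm (i + 2))) :=
    (injective_inclHomOfSubset_congr' eB rfl inter_subset_left inter_subset_left hx₁' hx₁).1 hbij.1
  have hak : (inclHomOfSubset (inter_subset_left : S (i + 2) ∩ (S i ∪ S (i + 1)) ⊆ S (i + 2)) x hx₁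
      (hxm (i + 2))).ker = ⊥ := (MonoidHom.ker_eq_bot_iff _).2 hai
  -- surjectivity of `π₁(F) → π₁(U)` and of `π₁(F) → π₁(X)`
  have hcompU : (inclHomOfSubset hF₁U x hx₁ hxU).comp (inclHomOfSubset hFF₁ x hx hx₁) =
      inclHomOfSubset hFU x hx hxU := inclHomOfSubset_comp hFF₁ hF₁U hx hx₁ hxU
  have hsU : Function.Surjective (inclHomOfSubset hFU x hx hxU) := by
    rw [← hcompU, MonoidHom.coe_comp]; exact hos.comp hψs
  have hcompX : (inclHom (S (i + 2) ∪ (S i ∪ S (i + 1))) x hxU).comp (inclHomOfSubset hFU x hx hxU) =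
      inclHom (⋂ m, S m) x hx := inclHom_comp_inclHomOfSubset hFU hx hxU
  have hUbij : Function.Bijective (inclHom (S (i + 2) ∪ (S i ∪ S (i + 1))) x hxU) :=
    ⟨(injective_inclHom_congr hU.symm (mem_univ x) hxU).1 (bijective_inclHom_univ x).1,
      (surjective_inclHom_congr hU.symm (mem_univ x) hxU).1 (bijective_inclHom_univ x).2⟩
  refine ⟨?_, ?_⟩
  · rw [← hcompX, MonoidHom.coe_comp]
    exact hUbij.2.comp hsU
  -- the kernel
  rw [← hcompX, MonoidHom.ker_comp_of_injective _ _ hUbij.1, ← hcompU, ← MonoidHom.comap_ker, hok, hak]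
  have h1 : SetLike.coe (⊥ : Subgroup (FundamentalGroup ↥(S (i + 2) ∩ (S i ∪ S (i + 1))) ⟨x, hx₁⟩)) ∪
      SetLike.coe (inclHomOfSubset (inter_subset_right :
        S (i + 2) ∩ (S i ∪ S (i + 1)) ⊆ S i ∪ S (i + 1)) x hx₁ (Or.inl (hxm i))).ker =
      SetLike.coe (inclHomOfSubset (inter_subset_right :
        S (i + 2) ∩ (S i ∪ S (i + 1)) ⊆ S i ∪ S (i + 1)) x hx₁ (Or.inl (hxm i))).ker :=
    union_eq_right.2 (by
      intro z hz
      rw [SetLike.mem_coe, Subgroup.mem_bot] at hz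
      rw [hz]; exact one_mem _)
  rw [h1]
  -- pull the normal closure back along `ψ`
  set b := inclHomOfSubset (inter_subset_right : S (i + 2) ∩ (S i ∪ S (i + 1)) ⊆ S i ∪ S (i + 1)) x hx₁
    (Or.inl (hxm i)) with hb
  set ψ := inclHomOfSubset hFF₁ x hx hx₁ with hψ
  have hker_le : ψ.ker ≤ Subgroup.normalClosure (ψ ⁻¹' (b.ker : Set _)) := by
    intro z hz
    apply Subgroup.subset_normalClosure
    rw [mem_preimage, SetLike.mem_coe, MonoidHom.mem_ker, (MonoidHom.mem_ker).1 hz, map_one]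
  rw [comap_normalClosure_of_surjective ψ hψs _ hker_le, preimage_ker_eq_ker_comp]
  -- `b ∘ ψ = ι₂ : π₁(F) → π₁(Xᵢ ∪ Xᵢ₊₁)`, through the handlebody `Xᵢ ∩ Xᵢ₊₁`
  have hFH : (⋂ m, S m) ⊆ S i ∩ S (i + 1) := fun y hy => ⟨mem_iInter.1 hy i, mem_iInter.1 hy (i + 1)⟩
  have hHU : S i ∩ S (i + 1) ⊆ S i ∪ S (i + 1) := inter_subset_left.trans subset_union_left
  have hxH : x ∈ S i ∩ S (i + 1) := hFH hx
  have hι₂ : b.comp ψ = (inclHomOfSubset hHU x hxH (Or.inl (hxm i))).comp (inclHomOfSubset hFH x hx hxH) := by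
    rw [hb, hψ, inclHomOfSubset_comp, inclHomOfSubset_comp]
  rw [hι₂, ← MonoidHom.comap_ker]
  -- inner step and pull-back along `ψ' : π₁(F) ↠ π₁(Xᵢ ∩ Xᵢ₊₁)`
  obtain ⟨-, hik⟩ := h.surjective_and_ker_eq_two_sectors i hx
  have eH : S (i + 2 + 1) ∩ S (i + 2 + 2) = S i ∩ S (i + 1) := by rw [e3, e4]
  have hψ's : Function.Surjective (inclHomOfSubset hFH x hx hxH) :=
    (surjective_inclHomOfSubset_congr' rfl eH (iInter_subset_inter S (i + 2)) hFH hx hx).1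
      (h.surjective_inclHomOfSubset_handlebody (i + 2) hx)
  rw [hik]
  set c₁ := inclHomOfSubset (inter_subset_left : S i ∩ S (i + 1) ⊆ S i) x hxH (hxm i) with hc₁
  set c₂ := inclHomOfSubset (inter_subset_right : S i ∩ S (i + 1) ⊆ S (i + 1)) x hxH (hxm (i + 1)) with hc₂
  set ψ' := inclHomOfSubset hFH x hx hxH with hψ'
  have hker_le' : ψ'.ker ≤ Subgroup.normalClosure (ψ' ⁻¹' ((c₁.ker : Set _) ∪ c₂.ker)) := by
    intro z hz
    apply Subgroup.subset_normalClosure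
    rw [mem_preimage]
    left
    rw [SetLike.mem_coe, MonoidHom.mem_ker, (MonoidHom.mem_ker).1 hz, map_one]
  rw [comap_normalClosure_of_surjective ψ' hψ's _ hker_le', preimage_union, preimage_ker_eq_ker_comp,
    preimage_ker_eq_ker_comp]
  -- `c₁ ∘ ψ' : π₁(F) → π₁(Xᵢ)`, `c₂ ∘ ψ' : π₁(F) → π₁(Xᵢ₊₁)`, with kernels `⟪K_{i+1} ∪ K_{i+2}⟫`,
  -- `⟪K_{i+2} ∪ Kᵢ⟫`
  have hcomp₁ : c₁.comp ψ' = inclHomOfSubset (iInter_subset S i) x hx (hxm i) := by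
    rw [hc₁, hψ', inclHomOfSubset_comp]
  have hcomp₂ : c₂.comp ψ' = inclHomOfSubset (iInter_subset S (i + 1)) x hx (hxm (i + 1)) := by
    rw [hc₂, hψ', inclHomOfSubset_comp]
  rw [hcomp₁, hcomp₂, h.ker_inclHomOfSubset_sector i hx, h.ker_inclHomOfSubset_sector (i + 1) hx,
    normalClosure_union_normalClosure]
  have hidem : ∀ s : Set (FundamentalGroup ↥(⋂ m, S m) ⟨x, hx⟩),
      Subgroup.normalClosure (SetLike.coe (Subgroup.normalClosure s)) = Subgroup.normalClosure s :=
    fun s => le_antisymm (Subgroup.normalClosure_le_normal fun z hz => hz)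
      (Subgroup.normalClosure_mono Subgroup.subset_normalClosure)
  rw [hidem]
  -- re-index the handlebodies `H_{i+1+1} = H_{i+2}`, `H_{i+1+2} = Hᵢ` and compare the generating sets
  have eK₁ : S (i + 1 + 1 + 1) ∩ S (i + 1 + 1 + 2) = S (i + 2 + 1) ∩ S (i + 2 + 2) := by rw [e1]
  have eK₂ : S (i + 1 + 2 + 1) ∩ S (i + 1 + 2 + 2) = S (i + 1) ∩ S (i + 2) := by rw [e2]
  rw [ker_inclHomOfSubset_congr eK₁ (iInter_subset_inter S (i + 1 + 1)) (iInter_subset_inter S (i + 2)) hx,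
    ker_inclHomOfSubset_congr eK₂ (iInter_subset_inter S (i + 1 + 2)) (iInter_subset_inter S i) hx]
  congr 1
  ext z
  simp only [mem_union]
  tauto

end Whole

/-! ### §7 Fact (a′): Abrams–Gay–Kirby's map `𝒢` takes values in group trisections -/

section Holds

/-- **Discharge of fact (a′) `isGroupTrisection_groupGKTrisectionOf` (Abrams–Gay–Kirby 2018,
p. 1540: the map `𝒢` from (parametrized, based) trisected `4`-manifolds to group trisections is
well defined; with Thm. 5).**  For a balanced `(g, k)`-trisection `S` (sectors with corners
along the central surface, `IsBalancedGKTrisection`) of a closed connected oriented smooth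
`4`-manifold `X`, a base point `x₀ ∈ F = ⋂ l, S l` and a marking `μ : S_g ≃* π₁(F, x₀)`, the
kernel triple `groupGKTrisectionOf h x₀ μ` is a `(g, k)` group trisection of `π₁(X, x₀)`.
Proof: the reduction `isGroupTrisection_groupGKTrisectionOf_of_fundamentalGroup`
(`TrisectionFunctorGKProofs.lean`, the algebra of Def. 1) fed with the four topological inputs,
all proved in the tree: (T1) `π₁(F) ↠ π₁(Hᵢ) ≅ F_g` and (T3) `π₁(∂X_l) ≅ π₁(X_l) ≅ F_k` (Morse
theory of `1`-handlebodies: `OneHandlebodyFundamentalGroup.lean`,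
`OneHandlebodyBoundaryFundamentalGroup.lean`), (T2) van Kampen for the Heegaard splittings
`∂X_l = Hᵢ ∪_F Hⱼ` and (T4) van Kampen for the three sectors (`VanKampenClosedCover.lean`, this
file), the geometry of the sectors (`TrisectionSectorCollars.lean`: collars, and
`∂X_l = S l ∩ (S i ∪ S j)` by invariance of the boundary).  Orientation, compactness and
connectedness of `X` are not used beyond what `IsGKTrisection` provides.
[cite: AbramsGayKirby2018, p. 1540 (the map 𝒢) and Thm. 5 (p. 1541)] -/
theorem isGroupTrisection_groupGKTrisectionOf_holds : isGroupTrisection_groupGKTrisectionOf.{u} := by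
  intro X _ _ _ _ _ _ _ _ g k S h x₀ μ
  have hx : (x₀ : X) ∈ ⋂ l, S l := x₀.2
  have hh : IsGKTrisection X g (fun _ => k) S := h
  have hφ : ∀ i, FundamentalGroup.map (centralInclusion S i) x₀ =
      inclHomOfSubset (iInter_subset_inter S i) (x₀ : X) x₀.2 (iInter_subset_inter S i x₀.2) := by
    intro i
    rw [FundamentalGroup.map_eq_mapOfEq]
    rfl
  have hι : FundamentalGroup.map (VanKampen.incl (⋂ l, S l)) x₀ = inclHom (⋂ l, S l) (x₀ : X) x₀.2 := by
    rw [FundamentalGroup.map_eq_mapOfEq]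
    rfl
  refine isGroupTrisection_groupGKTrisectionOf_of_fundamentalGroup h x₀ μ ?_ ?_ ?_ ?_
  · intro i
    rw [hφ]
    exact hh.surjective_inclHomOfSubset_handlebody i hx
  · intro i
    exact hh.isFreeOfRank_fundamentalGroup_handlebody i hx
  · intro i j hij
    rw [hφ, hφ]
    have hcases : ∀ i j : Fin 3, i ≠ j → j = i + 1 ∨ j = i + 2 := by decide
    rcases hcases i j hij with rfl | rfl
    · exact hh.isFreeOfRank_quotient_pair i hx
    · have hp := hh.isFreeOfRank_quotient_pair (i + 2) hx
      obtain ⟨-, -, e3, -⟩ := fin3_add i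
      have eK : S (i + 2 + 1 + 1) ∩ S (i + 2 + 1 + 2) = S (i + 1) ∩ S (i + 2) := by rw [e3]
      rw [ker_inclHomOfSubset_congr eK (iInter_subset_inter S (i + 2 + 1)) (iInter_subset_inter S i) hx,
        union_comm] at hp
      exact hp
  · rw [hι]
    obtain ⟨hs, hk⟩ := hh.surjective_inclHom_iInter_and_ker_eq 0 hx
    refine ⟨hs, ?_⟩
    rw [hk]
    congr 1
    ext z
    simp only [mem_iUnion, mem_union, hφ]
    constructor
    · rintro ((h0 | h1) | h2)
      exacts [⟨0, h0⟩, ⟨0 + 1, h1⟩, ⟨0 + 2, h2⟩]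
    · rintro ⟨m, hm⟩
      have hcases : ∀ m : Fin 3, m = 0 ∨ m = 0 + 1 ∨ m = 0 + 2 := by decide
      rcases hcases m with rfl | rfl | rfl
      exacts [Or.inl (Or.inl hm), Or.inl (Or.inr hm), Or.inr hm]

end Holds

end Literature.Topology.FourManifolds
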